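import Literature.MathematicalPhysics.QuantumFieldTheory.Balaban1983to89.B13Sqrt27AccretiveAlmostLocal
import Literature.MathematicalPhysics.QuantumFieldTheory.Balaban1983to89.B13Sqrt27AccretiveSquare
import Literature.MathematicalPhysics.QuantumFieldTheory.Balaban1983to89.Beta.CombesThomasForm

/-!
# `Balaban1983to89.B13Sqrt27AccretiveWitness` — NON-VACUITY of the hypotheses of `B13Sqrt27Accretive` ∕ `…Square` ∕
`…AlmostLocal` by a GENUINE, VOLUME-UNIFORM family: the nearest-neighbour graph Laplacian plus a mass plus a complex
diagonal potential, `T(u) = (L + μ) + u·V`, on ANY finite graph of degree `≤ δ` — accretive (`m = μ/2` for `|u| < μ/2`),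
almost local with `(e^{κd} − 1)`-weighted sums `≤ δ(e^κ − 1)`, entrywise affine (holomorphic) in `u`; so its square root
`T(u)^{−1/2}` decays like `(4/√(μ/2))·e^{−κd}`, is holomorphic in `u`, and squares to `T(u)⁻¹` — with constants depending on
`(μ, δ, κ)` only, NOT on the size of the graph (contrast: `B13TermWalkDataOneTorus` §3's junk packages, whose constants
blow up with the diameter)

statement-level skeleton of published theorems with citation tags; proofs where landed; nothing here is a claim about
the Yang–Mills mass gap

WHAT IS REPRODUCED (cell `pub-ymgap`, D-0062 Track A, seat `dag-n10-b` g2; a MODEL-level non-vacuity check in the A1–A6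
spirit of the cell's referee audits — NOT Bałaban's operators).  Data: a finite index set with a real pseudo-metric
`d ≥ 0`; symmetric nearest-neighbour conductances `0 ≤ c`, `c_{jk} ≠ 0 ⟹ d(j,k) = 1`, degree `Σ_l c_{il} ≤ δ`; the tree's
graph Laplacian `Beta.CombesThomasForm.lap c`; a mass `μ > 0`; a complex potential `|V_i| ≤ 1`; the family
`T(u) := (lap c + μ·1) + u·diag(V)`, `u ∈ ℂ`.
* **`accretive_model`** (`lap_form ≥ 0`) — `T(u)` is `μ/2`-accretive for `‖u‖ < μ/2`
  (`B13Sqrt27Accretive.accretive_of_coercive_add`);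
* **`weighted_rowSum_model`**, `weighted_colSum_model` — the `(e^{κd} − 1)`-weighted off-diagonal sums are `≤ δ(e^κ − 1)`;
* **`norm_invSqrt_model_le`** — for `δ(e^κ − 1) ≤ μ/4`: `‖(T(u)^{−1/2})_{ij}‖ ≤ (4/√(μ/2))·e^{−κ·d(i,j)}`
  (`B13Sqrt27AccretiveAlmostLocal.norm_invSqrt_apply_le_almostLocal`); `differentiableOn_invSqrt_model` (holomorphy in
  `u`, `B13Sqrt27Accretive.differentiableOn_invSqrt_apply`); `invSqrt_model_mul_self`
  (`B13Sqrt27AccretiveSquare.invSqrt_mul_invSqrt`).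
HONEST SCOPE.  A model family (finite graphs), showing the letters of the three modules are jointly inhabited with
volume-uniform constants; nothing of Bałaban's `Δ_k`, `C^{(k)}` is constructed or claimed; count-neutral; no
definition, no `sorry`.  NOT NODE O, NOT continuum, NOT Clay. [cite: Balaban1988RG2Cluster, (2.7) p.13, p.15]
-/

noncomputable section

open MeasureTheory Set Filter Topology Finset Metric
open scoped Matrix ComplexConjugate Real

namespace Literature.MathematicalPhysics.QuantumFieldTheory.Balaban1983to89.B13Sqrt27AccretiveWitness

open Literature.MathematicalPhysics.QuantumFieldTheory.Balaban1983to89.B13Sqrt27Accretive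
open Literature.MathematicalPhysics.QuantumFieldTheory.Balaban1983to89.B13Sqrt27AccretiveSquare (invSqrt_mul_invSqrt)
open Literature.MathematicalPhysics.QuantumFieldTheory.Balaban1983to89.B13Sqrt27AccretiveAlmostLocal
  (norm_invSqrt_apply_le_almostLocal)
open Literature.MathematicalPhysics.QuantumFieldTheory.Balaban1983to89.Beta.CombesThomasForm (lap lap_apply lap_form)

variable {n : Type*} [Fintype n] [DecidableEq n]

/-! ## §1. The model family `T(u) = (lap c + μ·1) + u·diag(V)` and its letters -/

/-- The graph Laplacian of non-negative symmetric conductances is a non-negative form. [folklore] -/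
private theorem lap_form_nonneg (c : n → n → ℝ) (hcs : ∀ j k, c j k = c k j) (hc0 : ∀ j k, 0 ≤ c j k) (v : n → ℝ) :
    0 ≤ v ⬝ᵥ (lap c).mulVec v := by
  rw [lap_form c hcs v]
  exact div_nonneg (Finset.sum_nonneg fun j _ => Finset.sum_nonneg fun k _ =>
    mul_nonneg (hc0 j k) (sq_nonneg _)) zero_le_two

/-- **The massive Laplacian is `μ`-coercive.** [folklore] -/
private theorem coercive_lap_add_mass (c : n → n → ℝ) (hcs : ∀ j k, c j k = c k j) (hc0 : ∀ j k, 0 ≤ c j k) (μ : ℝ) :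
    QGQInverse.Coercive (lap c + μ • (1 : Matrix n n ℝ)) μ := by
  intro x
  rw [Matrix.add_mulVec, dotProduct_add, Matrix.smul_mulVec, Matrix.one_mulVec, dotProduct_smul, smul_eq_mul]
  linarith [lap_form_nonneg c hcs hc0 x]

/-- **ACCRETIVITY of the model family**: for `‖u‖ < μ/2` and a potential `|V_i| ≤ 1`, `T(u) = (lap c + μ·1) + u·diag(V)` is
`μ/2`-accretive (`B13Sqrt27Accretive.accretive_of_coercive_add`). [cite: Balaban1988RG2Cluster, p.15] -/
theorem accretive_model (c : n → n → ℝ) (hcs : ∀ j k, c j k = c k j) (hc0 : ∀ j k, 0 ≤ c j k) {μ : ℝ} (hμ : 0 < μ)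
    (V : n → ℂ) (hV : ∀ i, ‖V i‖ ≤ 1) {u : ℂ} (hu : u ∈ ball (0 : ℂ) (μ / 2)) (v : n → ℂ) :
    μ / 2 * ∑ i, ‖v i‖ ^ 2 ≤
      (∑ i, star (v i) * (((lap c + μ • (1 : Matrix n n ℝ)).map (algebraMap ℝ ℂ) + u • Matrix.diagonal V) *ᵥ v) i).re := by
  have hu' : ‖u‖ ≤ μ / 2 := by
    rw [mem_ball, dist_zero_right] at hu; exact hu.le
  have hrow : ∀ i, ∑ j, ‖(u • Matrix.diagonal V) i j‖ ≤ μ / 2 := by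
    intro i
    rw [Finset.sum_eq_single i (fun j _ hji => by
      rw [Matrix.smul_apply, Matrix.diagonal_apply_ne _ (Ne.symm hji), smul_zero, norm_zero]) (by simp)]
    rw [Matrix.smul_apply, Matrix.diagonal_apply_eq, smul_eq_mul, norm_mul]
    calc ‖u‖ * ‖V i‖ ≤ μ / 2 * 1 := mul_le_mul hu' (hV i) (norm_nonneg _) (by linarith)
      _ = μ / 2 := mul_one _
  have hcol : ∀ j, ∑ i, ‖(u • Matrix.diagonal V) i j‖ ≤ μ / 2 := by
    intro j
    rw [Finset.sum_eq_single j (fun i _ hij => by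
      rw [Matrix.smul_apply, Matrix.diagonal_apply_ne _ hij, smul_zero, norm_zero]) (by simp)]
    rw [Matrix.smul_apply, Matrix.diagonal_apply_eq, smul_eq_mul, norm_mul]
    calc ‖u‖ * ‖V j‖ ≤ μ / 2 * 1 := mul_le_mul hu' (hV j) (norm_nonneg _) (by linarith)
      _ = μ / 2 := mul_one _
  have h := accretive_of_coercive_add (coercive_lap_add_mass c hcs hc0 μ) (P := u • Matrix.diagonal V)
    (by linarith : (0 : ℝ) ≤ μ / 2) hrow hcol v
  linarith

/-- **ALMOST-LOCALITY of the model family** (rows): with nearest-neighbour conductances (`c_{il} ≠ 0 ⟹ d(i,l) = 1`,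
`0 ≤ c ≤ 1` not needed beyond `0 ≤ c`, degree `Σ_l c_{il} ≤ δ`) the `(e^{κd} − 1)`-weighted off-diagonal row sums of `T(u)`
are `≤ δ(e^κ − 1)` for every `u` (the potential is diagonal and the diagonal carries weight `0`).
[cite: Balaban1988RG2Cluster, p.13] -/
theorem weighted_rowSum_model (d : n → n → ℝ) (hd0 : ∀ i, d i i = 0) (c : n → n → ℝ) (hc0 : ∀ j k, 0 ≤ c j k)
    (hcd : ∀ j k, c j k ≠ 0 → d j k = 1) {δ : ℝ} (hdeg : ∀ i, ∑ l, c i l ≤ δ) (μ : ℝ) {κ : ℝ} (hκ : 0 ≤ κ)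
    (V : n → ℂ) (u : ℂ) (i : n) :
    ∑ l, ‖((lap c + μ • (1 : Matrix n n ℝ)).map (algebraMap ℝ ℂ) + u • Matrix.diagonal V) i l‖
        * (Real.exp (κ * d i l) - 1) ≤ δ * (Real.exp κ - 1) := by
  have hterm : ∀ l, ‖((lap c + μ • (1 : Matrix n n ℝ)).map (algebraMap ℝ ℂ) + u • Matrix.diagonal V) i l‖
      * (Real.exp (κ * d i l) - 1) ≤ c i l * (Real.exp κ - 1) := by
    intro l
    by_cases hil : i = l
    · subst hil
      rw [hd0, mul_zero, Real.exp_zero, sub_self, mul_zero]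
      exact mul_nonneg (hc0 i i) (sub_nonneg.2 (Real.one_le_exp hκ))
    · have hentry : ((lap c + μ • (1 : Matrix n n ℝ)).map (algebraMap ℝ ℂ) + u • Matrix.diagonal V) i l
          = ((-c i l : ℝ) : ℂ) := by
        simp [Matrix.add_apply, Matrix.map_apply, Matrix.smul_apply, Matrix.one_apply_ne hil, lap_apply, hil]
      rw [hentry, Complex.norm_real, Real.norm_eq_abs, abs_neg, abs_of_nonneg (hc0 i l)]
      by_cases hcz : c i l = 0
      · rw [hcz, zero_mul, zero_mul]
      · rw [hcd i l hcz, mul_one]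
  calc ∑ l, ‖((lap c + μ • (1 : Matrix n n ℝ)).map (algebraMap ℝ ℂ) + u • Matrix.diagonal V) i l‖
          * (Real.exp (κ * d i l) - 1)
      ≤ ∑ l, c i l * (Real.exp κ - 1) := Finset.sum_le_sum fun l _ => hterm l
    _ = (∑ l, c i l) * (Real.exp κ - 1) := by rw [Finset.sum_mul]
    _ ≤ δ * (Real.exp κ - 1) := mul_le_mul_of_nonneg_right (hdeg i) (sub_nonneg.2 (Real.one_le_exp hκ))

/-- The same for columns (symmetric conductances). [cite: Balaban1988RG2Cluster, p.13] -/
theorem weighted_colSum_model (d : n → n → ℝ) (hd0 : ∀ i, d i i = 0) (hds : ∀ i j, d i j = d j i) (c : n → n → ℝ)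
    (hcs : ∀ j k, c j k = c k j) (hc0 : ∀ j k, 0 ≤ c j k) (hcd : ∀ j k, c j k ≠ 0 → d j k = 1) {δ : ℝ}
    (hdeg : ∀ i, ∑ l, c i l ≤ δ) (μ : ℝ) {κ : ℝ} (hκ : 0 ≤ κ) (V : n → ℂ) (u : ℂ) (l : n) :
    ∑ i, ‖((lap c + μ • (1 : Matrix n n ℝ)).map (algebraMap ℝ ℂ) + u • Matrix.diagonal V) i l‖
        * (Real.exp (κ * d i l) - 1) ≤ δ * (Real.exp κ - 1) := by
  have hterm : ∀ i, ‖((lap c + μ • (1 : Matrix n n ℝ)).map (algebraMap ℝ ℂ) + u • Matrix.diagonal V) i l‖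
      * (Real.exp (κ * d i l) - 1) ≤ c l i * (Real.exp κ - 1) := by
    intro i
    by_cases hil : i = l
    · subst hil
      rw [hd0, mul_zero, Real.exp_zero, sub_self, mul_zero]
      exact mul_nonneg (hc0 i i) (sub_nonneg.2 (Real.one_le_exp hκ))
    · have hentry : ((lap c + μ • (1 : Matrix n n ℝ)).map (algebraMap ℝ ℂ) + u • Matrix.diagonal V) i l
          = ((-c i l : ℝ) : ℂ) := by
        simp [Matrix.add_apply, Matrix.map_apply, Matrix.smul_apply, Matrix.one_apply_ne hil, lap_apply, hil]
      rw [hentry, Complex.norm_real, Real.norm_eq_abs, abs_neg, abs_of_nonneg (hc0 i l), hcs i l]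
      by_cases hcz : c l i = 0
      · rw [hcz, zero_mul, zero_mul]
      · rw [hds i l, hcd l i hcz, mul_one]
  calc ∑ i, ‖((lap c + μ • (1 : Matrix n n ℝ)).map (algebraMap ℝ ℂ) + u • Matrix.diagonal V) i l‖
          * (Real.exp (κ * d i l) - 1)
      ≤ ∑ i, c l i * (Real.exp κ - 1) := Finset.sum_le_sum fun i _ => hterm i
    _ = (∑ i, c l i) * (Real.exp κ - 1) := by rw [Finset.sum_mul]
    _ ≤ δ * (Real.exp κ - 1) := mul_le_mul_of_nonneg_right (hdeg l) (sub_nonneg.2 (Real.one_le_exp hκ))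

/-! ## §2. The conclusions for the model: volume-uniform decay of the square root, holomorphy, and the square identity -/

/-- **THE WITNESS.**  On ANY finite graph (real pseudo-metric `d ≥ 0`, nearest-neighbour symmetric conductances `0 ≤ c`,
`c_{jk} ≠ 0 ⟹ d(j,k) = 1`, degree `Σ_l c_{il} ≤ δ`), for every mass `μ > 0`, potential `|V_i| ≤ 1`, rate `κ ≥ 0` with
`δ(e^κ − 1) ≤ μ/4`, and every complex coupling `‖u‖ < μ/2`, the square root of `T(u) = (lap c + μ·1) + u·diag(V)` obeys
`‖(T(u)^{−1/2})_{ij}‖ ≤ (4/√(μ/2))·e^{−κ·d(i,j)}` — the constants see `(μ, δ, κ)` only, never the number of sites: the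
hypotheses of `B13Sqrt27AccretiveAlmostLocal.norm_invSqrt_apply_le_almostLocal` are met by a genuine, exponentially
localising, volume-uniform family (non-vacuity of the letters, beyond the junk packages of `B13TermWalkDataOneTorus` §3).
[cite: Balaban1988RG2Cluster, (2.7) p.13, p.15] -/
theorem norm_invSqrt_model_le (d : n → n → ℝ) (hd0 : ∀ i, d i i = 0) (hds : ∀ i j, d i j = d j i)
    (hdt : ∀ i j k, d i k ≤ d i j + d j k) (c : n → n → ℝ) (hcs : ∀ j k, c j k = c k j) (hc0 : ∀ j k, 0 ≤ c j k)
    (hcd : ∀ j k, c j k ≠ 0 → d j k = 1) {δ : ℝ} (hδ : 0 ≤ δ) (hdeg : ∀ i, ∑ l, c i l ≤ δ) {μ : ℝ} (hμ : 0 < μ)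
    (V : n → ℂ) (hV : ∀ i, ‖V i‖ ≤ 1) {κ : ℝ} (hκ : 0 ≤ κ) (hsmall : δ * (Real.exp κ - 1) ≤ μ / 4)
    {u : ℂ} (hu : u ∈ ball (0 : ℂ) (μ / 2)) (i j : n) :
    ‖invSqrt ((lap c + μ • (1 : Matrix n n ℝ)).map (algebraMap ℝ ℂ) + u • Matrix.diagonal V) i j‖
      ≤ 4 / Real.sqrt (μ / 2) * Real.exp (-(κ * d i j)) :=
  norm_invSqrt_apply_le_almostLocal d hd0 hds hdt _ (by linarith : 0 < μ / 2) hκ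
    (mul_nonneg hδ (sub_nonneg.2 (Real.one_le_exp hκ))) (by linarith : δ * (Real.exp κ - 1) ≤ μ / 2 / 2)
    (accretive_model c hcs hc0 hμ V hV hu) (weighted_rowSum_model d hd0 c hc0 hcd hdeg μ hκ V u)
    (weighted_colSum_model d hd0 hds c hcs hc0 hcd hdeg μ hκ V u) i j

/-- **Holomorphy of the model square root in the coupling** on the ball `‖u‖ < μ/2` (the model family is entrywise affine
in `u`; `B13Sqrt27Accretive.differentiableOn_invSqrt_apply` with `E = ℂ`). [cite: Balaban1988RG2Cluster, p.15] -/
theorem differentiableOn_invSqrt_model (c : n → n → ℝ) (hcs : ∀ j k, c j k = c k j) (hc0 : ∀ j k, 0 ≤ c j k)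
    {μ : ℝ} (hμ : 0 < μ) (V : n → ℂ) (hV : ∀ i, ‖V i‖ ≤ 1) (i j : n) :
    DifferentiableOn ℂ
      (fun u : ℂ => invSqrt ((lap c + μ • (1 : Matrix n n ℝ)).map (algebraMap ℝ ℂ) + u • Matrix.diagonal V) i j)
      (ball (0 : ℂ) (μ / 2)) := by
  refine differentiableOn_invSqrt_apply
    (fun u : ℂ => ((lap c + μ • (1 : Matrix n n ℝ)).map (algebraMap ℝ ℂ) + u • Matrix.diagonal V))
    (by linarith : 0 < μ / 2) (fun u hu => accretive_model c hcs hc0 hμ V hV hu) (fun k l => ?_) i j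
  simp only [Matrix.add_apply, Matrix.smul_apply, smul_eq_mul]
  exact (differentiableOn_const _).add (differentiableOn_id.mul (differentiableOn_const _))

/-- **The model square root squares to the covariance**: `T(u)^{−1/2}·T(u)^{−1/2} = T(u)⁻¹` for `‖u‖ < μ/2`
(`B13Sqrt27AccretiveSquare.invSqrt_mul_invSqrt`). [cite: Balaban1988RG2Cluster, (2.7) p.13] -/
theorem invSqrt_model_mul_self (c : n → n → ℝ) (hcs : ∀ j k, c j k = c k j) (hc0 : ∀ j k, 0 ≤ c j k)
    {μ : ℝ} (hμ : 0 < μ) (V : n → ℂ) (hV : ∀ i, ‖V i‖ ≤ 1) {u : ℂ} (hu : u ∈ ball (0 : ℂ) (μ / 2)) :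
    invSqrt ((lap c + μ • (1 : Matrix n n ℝ)).map (algebraMap ℝ ℂ) + u • Matrix.diagonal V)
        * invSqrt ((lap c + μ • (1 : Matrix n n ℝ)).map (algebraMap ℝ ℂ) + u • Matrix.diagonal V)
      = ((lap c + μ • (1 : Matrix n n ℝ)).map (algebraMap ℝ ℂ) + u • Matrix.diagonal V)⁻¹ :=
  invSqrt_mul_invSqrt _ (by linarith : 0 < μ / 2) (accretive_model c hcs hc0 hμ V hV hu)

end Literature.MathematicalPhysics.QuantumFieldTheory.Balaban1983to89.B13Sqrt27AccretiveWitness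

end
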